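import Summits.AtomisticToContinuum.HydrodynamicLimit.Theorems.CollisionIsometryCLTMacroClosureDefs
import Summits.AtomisticToContinuum.HydrodynamicLimit.Theorems.CollisionIsometryCLTHsFreeEnergyConvexBasic
import HarnessLib

/-!
# Vocabulary of the line `IdeatorTwoGen1Sketch` (barycentric Bregman / invariant Clausius) for the crux
`MacroClosure` (stmt-AtomisticToContinuum-14870; rank 6 of route `CollisionIsometryCLT`)

Definitions-only support file (`--supports stmt-AtomisticToContinuum-14870`) of the lead prover of the line
(`Cruxes/MacroClosure/Lines/IdeatorTwoGen1Sketch.lean`; skeleton registered on the item with the seven stubs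
`stub_chamber`, `stub_thermo`, `stub_balance`, `stub_blockMGF`, `stub_initialEntropy`, `stub_clausius`,
`stub_engine`). It extends the landed vocabulary `CollisionIsometryCLTMacroClosureDefs.lean` (namespace
`MacroClosureLine`: `hsEntropy`, `relEnt`, `stateOf`, `bρ`, `bU`, `AdmissibleKernel`, `Flow`, `ThermoChamber`,
`BalanceIdentity`, `EngineLocal`) by the three statements the new stubs prove or consume, so that each registered
stub can land in its own sorry-free Theorems file with the registered signature verbatim:

* `HomogeneousBlockMGF` — the ONE large-deviation object of the line: the sub-unit (`γ' < 1`) exponential moment of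
  the positive part of the block Bregman divergence `∫ₓ h_σ⁺(Ū_N(z,x) | U_c) dx` under the HOMOGENEOUS canonical law
  `localGibbsLaw σ 1 u_c θ_c` (flow-invariant), restricted to configurations all of whose blocks lie in the
  a-priori band `c₁ ≤ ρ̄ ≤ σ⁻³` of `AprioriBoundsPreShock` (ii); stated with `∫⁻`, so an infinite moment falsifies it;
* `InitialEntropyValue` — the `t = 0` specific relative entropy of the local Gibbs law against the homogeneous one,
  `(N+1)⁻¹ KL → ∫ₓ h_σ(stateOf ρ₀ u₀ θ₀ | stateOf 1 u_c θ_c) dx` for the law-of-large-numbers density profile `ρ₀`;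
* `ClausiusInMean` — the second law IN MEAN ON THE GOOD EVENT, uniformly in time: for measurable events
  `G_N ⊆ good` on which all blocks stay in the band up to `t₁ < T` and `P(G_Nᶜ) → 0`, eventually
  `E[𝟙_{G_N} ∫ₓ η_σ(Ū_N(Φ_s z, x)) dx] ≤ ∫ₓ η_σ(U_cl(0,x)) dx + δ` for all `s ≤ t₁` (with integrability).

Why "on the good event": the unconditioned expectation `E ∫ₓ η_σ(Ū_N)` is `+∞` at every finite `N` (a point of
`𝕋³` covered by a single kernel, or an isolated cold pair, makes `ρ̄ log(1/θ̄)` infinite / non-integrable on an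
event of positive probability), whereas on the band every block carries `≥ c₁(N+1)^{1−3γ}/C` particles. All bodies
are copied byte-for-byte from the registered skeleton; nothing is asserted here (every `def … : Prop` is a
statement the stubs prove or consume, never a hypothesis taken as a fact). The file also lands the first
registered sub-goal of the lead's `stub_engine`, the sure ENTROPY FLOOR `−(3/2)ρθ(U) − 1 ≤ η_σ(U)` on states with
`ρ ≥ 0`, `θ(U) ≥ 0` (it is what makes conditioning on the good event cost `P(G_Nᶜ)·O(1 + e_tot)` only). Idea card:
`Cruxes/MacroClosure/Ideas/barycentric-bregman-invariant-clausius.md` (Dafermos' relative entropy on the conditioned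
barycentre; Clausius in mean from Liouville invariance of the homogeneous law + entropy inequality + block MGF).
-/

noncomputable section

open MeasureTheory Filter Set Topology InformationTheory
open scoped ENNReal ContDiff

namespace Summit.AtomisticToContinuum.HydrodynamicLimit.Theorems.MacroClosureLine

open Literature.MathematicalPhysics.KineticTheory Literature.Analysis.FluidPDE
open Literature.Analysis.FunctionSpaces

/-! ## The three statements -/

/-- STATICS A — **homogeneous sub-unit block MGF on the band.** Under the HOMOGENEOUS canonical law
`localGibbsLaw σ 1 u_c θ_c` (flow-invariant, globally dilute for `σ < σ₀`), for every admissible kernel family,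
every band floor `c₁ > 0`, every tilt `γ' < 1` and every `ε > 0`, eventually in `N` and for all flows:
`E exp(γ'(N+1) · 𝟙{all blocks in the band c₁ ≤ ρ̄ ≤ σ⁻³} · ∫ₓ h_σ⁺(Ū_N(z,x) | U_c) dx) ≤ e^{ε(N+1)}`,
`U_c = stateOf 1 u_c θ_c`, `h_σ⁺ = max 0 relEnt` (so no convexity is presupposed). Varadhan's upper bound for
block empirical fields of the dilute hard-sphere Gibbs state; finite because on the band every block carries
`≥ c₁(N+1)^{1−3γ}/C → ∞` particles (cold blocks cost `θ̄^{(3n/2)(1−γ')}`) and dense blocks (packing `≤ 1`) are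
priced by the free-volume ceiling. Stated with `∫⁻` so that an infinite MGF falsifies it. -/
def HomogeneousBlockMGF : Prop :=
  ∃ σ₀ : ℝ, 0 < σ₀ ∧ ∀ σ : ℝ, 0 < σ → σ < σ₀ → ∀ (uc : V3) (θc : ℝ), 0 < θc →
    ∀ (γ C : ℝ) (φ : ℕ → T3 → ℝ), 0 < γ → γ ≤ 1 / 15 → AdmissibleKernel γ C φ →
    ∀ c₁ : ℝ, 0 < c₁ → ∀ γ' : ℝ, 0 < γ' → γ' < 1 → ∀ ε : ℝ, 0 < ε →
    ∀ᶠ N : ℕ in atTop, ∀ Φ : Flow σ N,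
      ∫⁻ z, ENNReal.ofReal (Real.exp (γ' * ((N : ℝ) + 1) *
          {z : Config (N + 1) (Fin 3) T3 |
              ∀ x, c₁ ≤ bρ (φ N) z x ∧ bρ (φ N) z x * σ ^ 3 ≤ 1}.indicator
            (fun z => ∫ x, max 0 (relEnt σ (bU (φ N) z x) (stateOf 1 uc θc))) z))
        ∂(localGibbsLaw σ (fun _ => 1) (fun _ => uc) (fun _ => θc) N Φ) ≤
      ENNReal.ofReal (Real.exp (ε * ((N : ℝ) + 1)))

/-- STATICS B — **the initial entropy value.** For continuous profiles and `σ < σ₀(profiles)`: if `ρ₀ > 0` is the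
law-of-large-numbers density profile of the local Gibbs laws `localGibbsLaw σ a₀ u₀ θ₀`, then their specific
relative entropy against the homogeneous law `localGibbsLaw σ 1 u_c θ_c` converges to the integrated Bregman
divergence of the hard-sphere entropy, `(N+1)⁻¹ KL → ∫ₓ h_σ(stateOf ρ₀ u₀ θ₀ | stateOf 1 u_c θ_c) dx`
(log-partition asymptotics of the dilute inhomogeneous canonical law — the activity–density relation is the
Euler–Lagrange equation of the variational formula — plus explicit Gaussian velocity integrals; exact for the ideal
gas). -/
def InitialEntropyValue : Prop :=
  ∀ (a₀ θ₀ : T3 → ℝ) (u₀ : T3 → V3), Continuous a₀ → Continuous θ₀ → Continuous u₀ →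
    (∀ x, 0 < a₀ x) → (∀ x, 0 < θ₀ x) →
    ∃ σ₀ : ℝ, 0 < σ₀ ∧ ∀ σ : ℝ, 0 < σ → σ < σ₀ → ∀ (uc : V3) (θc : ℝ), 0 < θc →
      ∀ ρ₀ : T3 → ℝ, Continuous ρ₀ → (∀ x, 0 < ρ₀ x) →
      ∀ Φ : (N : ℕ) → Flow σ N,
        (∀ χ : T3 → ℝ, Continuous χ → ∀ δ : ℝ, 0 < δ →
          Tendsto (fun N => localGibbsLaw σ a₀ u₀ θ₀ N (Φ N)
            {z | δ < |empiricalDensityField z χ - ∫ x, χ x * ρ₀ x|}) atTop (𝓝 0)) →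
        Tendsto (fun N : ℕ => (klDiv (localGibbsLaw σ a₀ u₀ θ₀ N (Φ N))
            (localGibbsLaw σ (fun _ => 1) (fun _ => uc) (fun _ => θc) N (Φ N))).toReal / ((N : ℝ) + 1))
          atTop (𝓝 (∫ x, relEnt σ (stateOf (ρ₀ x) (u₀ x) (θ₀ x)) (stateOf 1 uc θc)))

/-- **Clausius in mean on the good event, uniformly in time** (the admissibility input of the line): for all
profiles `∃ σ₀` such that for `σ < σ₀`, every classical hs-Euler solution on `[0,T)` whose `t = 0` fields are the
LLN limit of the local Gibbs laws, every flow family, every admissible kernel family, every band floor `c₁`, every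
`t₁ < T` and every family of measurable events `G_N` of good configurations on which ALL blocks stay in the band
`c₁ ≤ ρ̄ ≤ σ⁻³` up to time `t₁`, with `P(G_Nᶜ) → 0`: for every `δ > 0`, eventually in `N`, for ALL `s ∈ [0,t₁]`,
the block entropy functional is integrable on `G_N` and
`E[𝟙_{G_N} ∫ₓ η_σ(Ū_N(Φ_s z, x)) dx] ≤ ∫ₓ η_σ(U_cl(0,x)) dx + δ`. -/
def ClausiusInMean : Prop :=
  ∀ (a₀ θ₀ : T3 → ℝ) (u₀ : T3 → V3), Continuous a₀ → Continuous θ₀ → Continuous u₀ →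
    (∀ x, 0 < a₀ x) → (∀ x, 0 < θ₀ x) →
    ∃ σ₀ : ℝ, 0 < σ₀ ∧ ∀ σ : ℝ, 0 < σ → σ < σ₀ →
      ∀ (T : ℝ) (ρ θ : ℝ → T3 → ℝ) (u : ℝ → T3 → V3), IsHardSphereEulerSolution σ T ρ u θ →
        ∀ Φ : (N : ℕ) → Flow σ N,
          TendstoHydroFieldsAt (fun N => localGibbsLaw σ a₀ u₀ θ₀ N (Φ N)) Φ ρ u θ 0 →
          ∀ (γ C : ℝ) (φ : ℕ → T3 → ℝ), 0 < γ → γ ≤ 1 / 15 → AdmissibleKernel γ C φ →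
          ∀ (c₁ t₁ : ℝ), 0 < c₁ → 0 < t₁ → t₁ < T →
          ∀ G : (N : ℕ) → Set (Config (N + 1) (Fin 3) T3), (∀ N, MeasurableSet (G N)) →
            (∀ N, G N ⊆ (Φ N).good) →
            (∀ N, ∀ z ∈ G N, ∀ s ∈ Icc 0 t₁, ∀ x,
                c₁ ≤ bρ (φ N) ((Φ N).flow s z) x ∧ bρ (φ N) ((Φ N).flow s z) x * σ ^ 3 ≤ 1) →
            Tendsto (fun N => localGibbsLaw σ a₀ u₀ θ₀ N (Φ N) (G N)ᶜ) atTop (𝓝 0) →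
            ∀ δ : ℝ, 0 < δ → ∀ᶠ N : ℕ in atTop, ∀ s ∈ Icc 0 t₁,
              Integrable (fun z => (G N).indicator
                  (fun z => ∫ x, hsEntropy σ (bU (φ N) ((Φ N).flow s z) x)) z)
                (localGibbsLaw σ a₀ u₀ θ₀ N (Φ N)) ∧
              ∫ z, (G N).indicator (fun z => ∫ x, hsEntropy σ (bU (φ N) ((Φ N).flow s z) x)) z
                  ∂(localGibbsLaw σ a₀ u₀ θ₀ N (Φ N)) ≤
                (∫ x, hsEntropy σ (stateOf (ρ 0 x) (u 0 x) (θ 0 x))) + δ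


namespace Barycentric

/-- **Entropy floor** (registered sub-goal `stub_engine_entropyFloor` of the lead's `stub_engine`): for every state
with `ρ ≥ 0` and non-negative temperature `θ(U) ≥ 0` (all block states of non-negative kernels are such, by
Cauchy–Schwarz), `−(3/2) ρ θ(U) − 1 ≤ η_σ(U)` — since `ρ f_ex ≥ 0` (`hsExcessFreeEnergy_nonneg`, junk value
included), `ρ log ρ ≥ ρ − 1 ≥ −1` and `log θ ≤ θ` (with `log 0 = 0`). As `(3/2)ρ̄θ̄ ≤ Ē`, the block entropy
functional is bounded below by `−e_tot(z) − 1` surely, which is what pays the bad event inside conditional means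
without any rate. [folklore] -/
theorem stub_engine_entropyFloor :
    ∀ (σ : ℝ) (U : State), 0 ≤ U.1 → 0 ≤ stateTemp U →
      -(3 / 2 * (U.1 * stateTemp U)) - 1 ≤ hsEntropy σ U := by
  intro σ U hρ hθ
  -- `log θ ≤ θ` for `θ ≥ 0`
  have hlog : Real.log (stateTemp U) ≤ stateTemp U := by
    rcases hθ.eq_or_lt with h | h
    · rw [← h, Real.log_zero]
    · linarith [Real.log_le_sub_one_of_pos h]
  -- `ρ log ρ ≥ -1` for `ρ ≥ 0`
  have hxlogx : -1 ≤ U.1 * Real.log U.1 := by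
    rcases hρ.eq_or_lt with h | h
    · rw [← h]; simp
    · have h1 : 1 - U.1⁻¹ ≤ Real.log U.1 := Real.one_sub_inv_le_log_of_pos h
      have h2 : U.1 * (1 - U.1⁻¹) = U.1 - 1 := by field_simp
      nlinarith [mul_le_mul_of_nonneg_left h1 hρ]
  have hf : 0 ≤ U.1 * hsExcessFreeEnergy (U.1 * σ ^ 3) :=
    mul_nonneg hρ (HsFreeEnergyConvex.hsExcessFreeEnergy_nonneg _)
  have hkin : U.1 * Real.log (stateTemp U) ≤ U.1 * stateTemp U := mul_le_mul_of_nonneg_left hlog hρ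
  have hexp : hsEntropy σ U = -(3 / 2) * (U.1 * Real.log (stateTemp U)) + U.1 * Real.log U.1 +
      U.1 * hsExcessFreeEnergy (U.1 * σ ^ 3) := by
    simp only [hsEntropy, stateTemp]; ring
  rw [hexp]
  nlinarith

end Barycentric


/-! ## Kernel-parametrised forms (appended 2026-08-16T22Z, reshape of the statics bill)

`CollisionalTransferLocality`, `AprioriBoundsPreShock`, `FastMomentRelaxationPreShock` are quantified over ALL
admissible kernel families, so the engine may FIX one family. The statics inputs are therefore only needed for
one family — e.g. box-smoothed kernels `ψ * b_ℓ`, for which the block Bregman functional splits exactly over a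
tiling by cubes (see the stub_blockMGF work notes): `BlockMGFFor` / `ClausiusInMeanFor` are the bodies of
`HomogeneousBlockMGF` / `ClausiusInMean` at a given family `(γ, C, φ)`. -/

/-- `HomogeneousBlockMGF` at ONE kernel family `(γ, C, φ)` (same body, family fixed). -/
def BlockMGFFor (γ C : ℝ) (φ : ℕ → T3 → ℝ) : Prop :=
  ∃ σ₀ : ℝ, 0 < σ₀ ∧ ∀ σ : ℝ, 0 < σ → σ < σ₀ → ∀ (uc : V3) (θc : ℝ), 0 < θc →
    0 < γ → γ ≤ 1 / 15 → AdmissibleKernel γ C φ →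
    ∀ c₁ : ℝ, 0 < c₁ → ∀ γ' : ℝ, 0 < γ' → γ' < 1 → ∀ ε : ℝ, 0 < ε →
    ∀ᶠ N : ℕ in atTop, ∀ Φ : Flow σ N,
      ∫⁻ z, ENNReal.ofReal (Real.exp (γ' * ((N : ℝ) + 1) *
          {z : Config (N + 1) (Fin 3) T3 |
              ∀ x, c₁ ≤ bρ (φ N) z x ∧ bρ (φ N) z x * σ ^ 3 ≤ 1}.indicator
            (fun z => ∫ x, max 0 (relEnt σ (bU (φ N) z x) (stateOf 1 uc θc))) z))
        ∂(localGibbsLaw σ (fun _ => 1) (fun _ => uc) (fun _ => θc) N Φ) ≤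
      ENNReal.ofReal (Real.exp (ε * ((N : ℝ) + 1)))

/-- `ClausiusInMean` at ONE kernel family `(γ, C, φ)` (same body, family fixed). -/
def ClausiusInMeanFor (γ C : ℝ) (φ : ℕ → T3 → ℝ) : Prop :=
  ∀ (a₀ θ₀ : T3 → ℝ) (u₀ : T3 → V3), Continuous a₀ → Continuous θ₀ → Continuous u₀ →
    (∀ x, 0 < a₀ x) → (∀ x, 0 < θ₀ x) →
    ∃ σ₀ : ℝ, 0 < σ₀ ∧ ∀ σ : ℝ, 0 < σ → σ < σ₀ →
      ∀ (T : ℝ) (ρ θ : ℝ → T3 → ℝ) (u : ℝ → T3 → V3), IsHardSphereEulerSolution σ T ρ u θ →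
        ∀ Φ : (N : ℕ) → Flow σ N,
          TendstoHydroFieldsAt (fun N => localGibbsLaw σ a₀ u₀ θ₀ N (Φ N)) Φ ρ u θ 0 →
          0 < γ → γ ≤ 1 / 15 → AdmissibleKernel γ C φ →
          ∀ (c₁ t₁ : ℝ), 0 < c₁ → 0 < t₁ → t₁ < T →
          ∀ G : (N : ℕ) → Set (Config (N + 1) (Fin 3) T3), (∀ N, MeasurableSet (G N)) →
            (∀ N, G N ⊆ (Φ N).good) →
            (∀ N, ∀ z ∈ G N, ∀ s ∈ Icc 0 t₁, ∀ x,
                c₁ ≤ bρ (φ N) ((Φ N).flow s z) x ∧ bρ (φ N) ((Φ N).flow s z) x * σ ^ 3 ≤ 1) →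
            Tendsto (fun N => localGibbsLaw σ a₀ u₀ θ₀ N (Φ N) (G N)ᶜ) atTop (𝓝 0) →
            ∀ δ : ℝ, 0 < δ → ∀ᶠ N : ℕ in atTop, ∀ s ∈ Icc 0 t₁,
              Integrable (fun z => (G N).indicator
                  (fun z => ∫ x, hsEntropy σ (bU (φ N) ((Φ N).flow s z) x)) z)
                (localGibbsLaw σ a₀ u₀ θ₀ N (Φ N)) ∧
              ∫ z, (G N).indicator (fun z => ∫ x, hsEntropy σ (bU (φ N) ((Φ N).flow s z) x)) z
                  ∂(localGibbsLaw σ a₀ u₀ θ₀ N (Φ N)) ≤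
                (∫ x, hsEntropy σ (stateOf (ρ 0 x) (u 0 x) (θ 0 x))) + δ

namespace Barycentric

/-- **`clausiusInMeanFor_of` (registered structural sub-goal):** the all-families Clausius statement gives
the kernel-parametrised one for every family. [folklore] -/
theorem clausiusInMeanFor_of : ClausiusInMean → ∀ (γ C : ℝ) (φ : ℕ → T3 → ℝ), ClausiusInMeanFor γ C φ := by
  intro h γ C φ a₀ θ₀ u₀ ha hθ hu ha0 hθ0
  obtain ⟨σ₀, hσ₀, H⟩ := h a₀ θ₀ u₀ ha hθ hu ha0 hθ0
  refine ⟨σ₀, hσ₀, fun σ hσ hσlt T ρ θ u hE Φ hT hγ hγ15 hφ => ?_⟩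
  exact H σ hσ hσlt T ρ θ u hE Φ hT γ C φ hγ hγ15 hφ

/-- **`blockMGFFor_of` (registered structural sub-goal):** the all-families block MGF gives the
kernel-parametrised one for every family. [folklore] -/
theorem blockMGFFor_of : HomogeneousBlockMGF → ∀ (γ C : ℝ) (φ : ℕ → T3 → ℝ), BlockMGFFor γ C φ := by
  intro h γ C φ
  obtain ⟨σ₀, hσ₀, H⟩ := h
  refine ⟨σ₀, hσ₀, fun σ hσ hσlt uc θc hθc hγ hγ15 hφ => ?_⟩
  exact H σ hσ hσlt uc θc hθc γ C φ hγ hγ15 hφ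

end Barycentric

end Summit.AtomisticToContinuum.HydrodynamicLimit.Theorems.MacroClosureLine

end
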